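import Literature.MathematicalPhysics.QuantumFieldTheory.Balaban1983to89.B9SectBGReadCodedY
import Literature.MathematicalPhysics.QuantumFieldTheory.Balaban1983to89.Node00.OpsYCoarseBondRepFaces
import Literature.MathematicalPhysics.QuantumFieldTheory.Balaban1983to89.B9Thm310CommutatorBound389B
import Literature.MathematicalPhysics.QuantumFieldTheory.Balaban1983to89.B9Eq3104CommutatorSupport

/-!
# Balaban [B9], (3.12)–(3.16) pp. 392–393, (3.24)∕(3.26) pp. 394–395 — THE (3.15) BLOCK MAJORANTS OF `Q(U)`, `Q*(U)` AND THE DIAGONAL WEIGHT `a` AT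
# NODE 00's LETTERS, IN r06's FRAME SHAPE: ★★ `hasMajorant_QbC`, ★★ `hasMajorant_QsbC`, ★★ `hasMajorant_abC`
# (pub-ymgap N06 G-side plan, Route L, L-4b: the fields `hQb ∕ hQsb ∕ ha324` of `B9SectBGFrameV4.GFrame₄` for the instance `gFrame₄CodedOn`)

T. Bałaban, *Propagators for lattice gauge theories in a background field*, Commun. Math. Phys. **99** (1985) 389–434
[`Balaban1985BackgroundPropagators`, "B9"]; [4] = T. Bałaban, *Propagators and renormalization transformations for lattice gauge
theories. II*, Commun. Math. Phys. **96** (1984) 223–250 [`Balaban1984PropagatorsII`].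

statement-level skeleton of published theorems with citation tags; proofs where landed; nothing here is a claim about the
Yang–Mills mass gap

THE PRINTED LOCI.  (3.12)–(3.14) p. 393 (`Q(U)`: averages of parallel transports along the straight contours of the double block of a coarse bond — a LOCAL
operator with nonnegative weights of total mass one); (3.13) (`Q*`: the adjoint for the weighted pairings); (3.15) p. 393 (their sizes); (3.24) p. 394, (3.26)
p. 395 (the diagonal weight `a`: `a_j(Lʲη)^{−2}` on level `j`, `a(1 − L⁻²) < a_j ≦ a`); [4] (2.51) p. 232 (block majorants).

WHY THIS FILE (seat dag-n06-c gen 13).  r06's G frame displays `hQb ∕ hQsb` — block majorants `κQb·e^{−δd}` of the bond letters `Qb U`, `Qsb U` at regular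
bases, for every rate `0 < δ ≦ δcap`, with a FRAME-LEVEL `κQb` — and `ha324` — `ab` block-diagonal with entries `≦ ā·ℓ(a)^{−2}`, frame-level `ā`.  For the
instance letters of `B9SectBGWordDeltaAY` (`QbC = conj b (bondOpCoordsY (QbY parB U))`, `QsbC` ∕ `abC` on the REBALANCED `QsbVY = QsY∘diag(vol)∘res`,
`abVY = ext∘diag(w∕vol)∘res`) THIS FILE proves them from node00-def-Y's kernel faces, read through g7's «reading ⇒ majorant» lemma
(`B9SectBGpReadingsY.hasMajorant_conj_of_liftY_bound`) and gen 13's carrier transport (`B9SectBGReadCodedY`):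
* ★★ `hasMajorant_QbC` — `κ = M₂Σ_j‖b_j‖·e^{δ(ℓ+3)}`: `Q(U)` does not increase norms (`B9Eq3132Ineq2142Covariant.norm_QY_apply_le`: weights `q ≥ 0` of mass
  `1`, contractive transporters) and its contour bonds lie within `ℓ + 3` of the block of the anchored representative (def-Y's
  `Node00.geo9K_dist_lab_of_qK_ne_zero`, FILE 62);
* ★★ `hasMajorant_QsbC` — `κ = M₂Σ_j‖b_j‖·2L^{d+1}·e^{δ(ℓ+3)}`: the column sums of `qsK = qKᵀ` are `≦ 2(L^{d+1})^{−J₀(b)}`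
  (`B9Thm310CommutatorBound389B.sum_abs_qsK_le`), the volume factor of an averaging index bond is `≦ (L^{d+1})^{J₀(b)+1}` (level window
  `B9Eq3104CommutatorSupport.levY_src_bounds_of_qwt_ne_zero`), locality by `geo9K_dist_lab_of_qsK_ne_zero`;
* ★★ `hasMajorant_abC` — `ā = M₂Σ_j‖b_j‖·b₁`: the index band `i.hwb` (`w_ι∕(c_f∕L^{j})² ≦ b₁(L^{j})^{d+1}`) IS `w_ι∕vol(ι) ≦ b₁·ℓ(ι)^{−2}` (`geo9K_len_eq`), and
  the representative's block is `β ι` (`Node00.blkY_repBondY_src`).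
All three at every `U` whose averaging transporters `parB U` are contractive with contractive inverses (G-valued `U` at the record), every `δ ≥ 0`.

HONEST SCOPE.  Finite-dimensional bookkeeping estimates on DEFINED kernels (no analysis of [B9] asserted); count-neutral; N06 NOT discharged; nothing continuum ∕
OS ∕ mass-gap ∕ Clay.  No `sorry`, no `axiom`, no `def`, no `instance`.  `--supports stmt-QuantumFields-27364`.

RELATED IN THE TREE, NOT DUPLICATED: `B9SectBKerLettersY.hasMajorantHom_QcC_base` (gen 12: the site-sector `Q′`), pv `B9Thm39CinvSandwichQ` (site `Q′` locality),
`Node00.OpsYCoarseBondRep ∕ …Faces` (def-Y — USED), `B9Eq3132Ineq2142Covariant` ∕ `B9Thm310CommutatorBound389B` ∕ `B9Eq3104CommutatorSupport` (def-Y∕n06 — USED).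
-/

noncomputable section

namespace Literature.MathematicalPhysics.QuantumFieldTheory.Balaban1983to89.B9SectBQSizesY

open Literature.MathematicalPhysics.QuantumFieldTheory.Balaban1983to89
open Literature.MathematicalPhysics.QuantumFieldTheory.Balaban1983to89.Node00 (SiteY BlkY FBondY IBondY CfgY BondParY UboxY shiftY qT qK qsK QY QsY aY liftY
  liftY_apply liftMatY liftMatY_diagonal_apply trLiftY_apply QbY QbY_apply_repBondY QbY_apply_of_not_mem_range repBondY resBondY resBondY_apply extBondY
  extBondY_apply_repBondY extBondY_apply_of_not_mem_range bondCoordsY bondFunCoordsY bondCoordsY_apply blkY_repBondY_src geo9K_dist_lab_of_qK_ne_zero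
  geo9K_dist_lab_of_qsK_ne_zero levY)
open Literature.MathematicalPhysics.QuantumFieldTheory.Balaban1983to89.Node00.OpsYNablaBridge (chartY)
open Literature.MathematicalPhysics.QuantumFieldTheory.Balaban1983to89.B9Eq360DeltaPrimeAY (blkY AfldY)
open Literature.MathematicalPhysics.QuantumFieldTheory.Balaban1983to89.B6Ineq2142KLevelV1 (β lvl)
open Literature.MathematicalPhysics.QuantumFieldTheory.Balaban1983to89.B6KLevelCensusIndexV1 (KIdx kGeo)
open Literature.MathematicalPhysics.QuantumFieldTheory.Balaban1983to89.B6RandomWalk (HasMajorant hasMajorant_mono)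
open Literature.MathematicalPhysics.QuantumFieldTheory.Balaban1983to89.B9Thm34Ext (toB6)
open Literature.MathematicalPhysics.QuantumFieldTheory.Balaban1983to89.B9GeoNormsKLevelV1 (geo9K)
open Literature.MathematicalPhysics.QuantumFieldTheory.Balaban1983to89.B9GeoLemma21KLevelV1 (geo9K_dist_comm)
open Literature.MathematicalPhysics.QuantumFieldTheory.Balaban1983to89.B9Eq39Adjoint (R)
open Literature.MathematicalPhysics.QuantumFieldTheory.Balaban1983to89.B9Eq352DivFormLetters (conj)
open Literature.MathematicalPhysics.QuantumFieldTheory.Balaban1983to89.B9Eq360Vprime (norm_R_le_of_unit)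
open Literature.MathematicalPhysics.QuantumFieldTheory.Balaban1983to89.B9SectBGpLettersY (decY decY_base blkC)
open Literature.MathematicalPhysics.QuantumFieldTheory.Balaban1983to89.B9SectBGpReadingsY (hasMajorant_conj_of_liftY_bound)
open Literature.MathematicalPhysics.QuantumFieldTheory.Balaban1983to89.B9SectBCodedCarrier (CCfg)
open Literature.MathematicalPhysics.QuantumFieldTheory.Balaban1983to89.B9Eq3132Ineq2142Covariant (norm_QY_apply_le qK_apply)
open Literature.MathematicalPhysics.QuantumFieldTheory.Balaban1983to89.B9Thm310CommutatorBound389B (sum_abs_qsK_le)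
open Literature.MathematicalPhysics.QuantumFieldTheory.Balaban1983to89.B9Eq3104CommutatorSupport (levY_src_bounds_of_qwt_ne_zero)
open Literature.MathematicalPhysics.QuantumFieldTheory.Balaban1983to89.B9Thm37CommutatorBound389 (geo9K_len_eq)
open Literature.MathematicalPhysics.QuantumFieldTheory.Balaban1983to89.B9SectBGWordDeltaAY (bondOpCoordsRY bondOpCoordsRY_apply restrictScalars_bondOpCoordsY volY
  volY_pos QsbVY abVY QbC QsbC abC)
open Literature.MathematicalPhysics.QuantumFieldTheory.Balaban1983to89.B9SectBGReadCodedY (hasMajorant_of_eq)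
open Literature.MathematicalPhysics.QuantumFieldTheory.Balaban1983to89.B9Eq3104CommutatorSizesAvg (sum_abs_qK_eq_one)

variable {d ℓ : ℕ} {hd : 1 ≤ d + 1} {hL : Odd (ℓ + 1) ∧ 1 < ℓ + 1} {b₀ b₁ : ℝ}
variable {𝔸 : Type} [NormedRing 𝔸] [NormedAlgebra ℂ 𝔸] [CompleteSpace 𝔸]
variable {ι : Type} [Fintype ι]
variable (i : KIdx d ℓ hd hL b₀ b₁) (parB : BondParY 𝔸 i) (b : Module.Basis ι ℝ 𝔸) (ιB : BlkY i → IBondY i)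
  [Fintype (geo9K i).Site] {Rr : ℝ} {Hp : Prop}

/-! ## §1 Bookkeeping on the coordinate change of product-form inputs -/

omit [CompleteSpace 𝔸] [Fintype (geo9K i).Site] in
/-- the inverse coordinate change of a product-form bond function is product-form. [cite: Balaban1985BackgroundPropagators, (3.1) p.390, bookkeeping] -/
theorem bondFunCoordsY_symm_liftY (f : Fin (d + 1) × SiteY i → ℝ) (E : 𝔸) (bd : FBondY i) :
    (bondFunCoordsY i).symm (liftY f E) bd = ((f (bondCoordsY i bd) : ℝ) : ℂ) • E := by
  rw [Node00.bondFunCoordsY_symm_apply, liftY_apply]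

omit [CompleteSpace 𝔸] [Fintype (geo9K i).Site] in
/-- the norm of a product-form value with `‖E‖ ≦ 1`. [cite: Balaban1985BackgroundPropagators, (3.39) p.397, bookkeeping] -/
theorem norm_real_smul_le {t : ℝ} {E : 𝔸} (hE : ‖E‖ ≤ 1) : ‖((t : ℝ) : ℂ) • E‖ ≤ |t| := by
  rw [norm_smul, Complex.norm_real, Real.norm_eq_abs]
  exact (mul_le_mul_of_nonneg_left hE (abs_nonneg t)).trans (mul_one _).le

omit [NormedRing 𝔸] [NormedAlgebra ℂ 𝔸] [CompleteSpace 𝔸] [Fintype ι] [Fintype (geo9K i).Site] in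
/-- the exponential profile at a pair of blocks within `r`: `1 ≦ e^{δr}·e^{−δ·dist}` for `δ ≥ 0`. [cite: Balaban1984PropagatorsII, (2.54) p.233, bookkeeping] -/
theorem one_le_exp_mul_exp_neg {δ r D : ℝ} (hδ : 0 ≤ δ) (hD : D ≤ r) : 1 ≤ Real.exp (δ * r) * Real.exp (-(δ * D)) := by
  rw [← Real.exp_add]
  exact Real.one_le_exp (by nlinarith)

/-! ## §2 ★★ `Q(U)` read on fine bonds: FIELD `hQb` -/

/-- ★★ **THE (3.15) BLOCK MAJORANT OF `Qb = Q(U)`** at a configuration with contractive averaging transporters: for every `δ ≥ 0`,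
`QbC parB b (base U) ≺ (M₂Σ_j‖b_j‖)·e^{δ(ℓ+3)}·e^{−δ·d}` (block map `blkC ι_B ∘ snd ∘ fst`). [cite: Balaban1985BackgroundPropagators, (3.12)–(3.15) pp.392–393; Balaban1984PropagatorsII, (2.51) p.232] -/
theorem hasMajorant_QbC (hι : ∀ s : BlkY i, β i.hN i.D i.hk (ιB s) = s) {M₂ : ℝ} (hM₂ : 0 ≤ M₂)
    (hrepr : ∀ (v : 𝔸) (j : ι), |b.repr v j| ≤ M₂ * ‖v‖) {U : CfgY 𝔸 i}
    (hparU : ∀ s s', ‖(parB U s s' : 𝔸)‖ ≤ 1 ∧ ‖(((parB U s s')⁻¹ : 𝔸ˣ) : 𝔸)‖ ≤ 1) {δ : ℝ} (hδ : 0 ≤ δ) :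
    HasMajorant (g := toB6 (geo9K i) Rr Hp) (fun q : (Fin (d + 1) × SiteY i) × ι => blkC i ιB q.1.2) (QbC i parB b (.base U))
      (fun a a' => (M₂ * ∑ j, ‖b j‖) * (Real.exp (δ * ((ℓ : ℝ) + 3)) * Real.exp (-(δ * (geo9K i).dist a a')))) := by
  classical
  have hQ : QbC i parB b (.base U) = conj b (bondOpCoordsRY i ((QbY i parB U).restrictScalars ℝ)) := by
    rw [QbC, restrictScalars_bondOpCoordsY, decY_base]
  refine hasMajorant_of_eq i hQ (hasMajorant_conj_of_liftY_bound b (g := toB6 (geo9K i) Rr Hp) (fun z : Fin (d + 1) × SiteY i => blkC i ιB z.2)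
    _ _ M₂ hM₂ hrepr fun f E y' B hE hB hoff hbd z => ?_)
  rw [bondOpCoordsRY_apply, LinearMap.restrictScalars_apply, Node00.bondFunCoordsY_apply]
  set Λ : FBondY i → 𝔸 := (bondFunCoordsY i).symm (liftY f E) with hΛ
  by_cases hz : (bondCoordsY i).symm z ∈ Set.range (repBondY i)
  · obtain ⟨κ, hκ⟩ := hz
    rw [← hκ, QbY_apply_repBondY]
    -- the block of the evaluation bond is the block of the representative's initial point
    have hz2 : z.2 = B6GlobalChartV1.boxEquiv i.hN (repBondY i κ).src := by
      have : z = bondCoordsY i (repBondY i κ) := by rw [hκ, Equiv.apply_symm_apply]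
      rw [this, bondCoordsY_apply]
    by_cases hex : ∃ f' : FBondY i, qK i κ f' ≠ 0 ∧ blkC i ιB (B6GlobalChartV1.boxEquiv i.hN f'.src) = y'
    · obtain ⟨f', hf', hy'⟩ := hex
      have hdist : (geo9K i).dist (blkC i ιB z.2) y' ≤ (ℓ : ℝ) + 3 := by
        rw [hz2, ← hy']; exact geo9K_dist_lab_of_qK_ne_zero i ιB hι hf'
      have hS : ‖QY i parB U Λ κ‖ ≤ B := by
        refine norm_QY_apply_le i parB U hparU Λ κ fun f'' _ => ?_
        rw [hΛ, bondFunCoordsY_symm_liftY]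
        exact (norm_real_smul_le hE).trans (hbd _)
      calc ‖QY i parB U Λ κ‖ ≤ B := hS
        _ = 1 * B := (one_mul B).symm
        _ ≤ _ := mul_le_mul_of_nonneg_right (one_le_exp_mul_exp_neg hδ hdist) hB
    · -- no contour bond of `κ` meets the block `y′`: the average vanishes
      have hS : ‖QY i parB U Λ κ‖ ≤ 0 := by
        refine norm_QY_apply_le i parB U hparU Λ κ fun f'' hf'' => ?_
        rw [hΛ, bondFunCoordsY_symm_liftY]
        have hq : qK i κ f'' ≠ 0 := by rw [qK_apply]; exact hf''
        have hoff' : f (bondCoordsY i f'') = 0 := by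
          refine hoff _ fun h => hex ⟨f'', hq, ?_⟩
          rw [← h, bondCoordsY_apply]
        rw [hoff', Complex.ofReal_zero, zero_smul, norm_zero]
      refine hS.trans (mul_nonneg (mul_nonneg (Real.exp_pos _).le (Real.exp_pos _).le) hB)
  · rw [QbY_apply_of_not_mem_range i parB U Λ hz, norm_zero]
    exact mul_nonneg (mul_nonneg (Real.exp_pos _).le (Real.exp_pos _).le) hB

/-! ## §3 ★★ `Q*(U)·vol` read on fine bonds: FIELD `hQsb` -/

omit [NormedRing 𝔸] [NormedAlgebra ℂ 𝔸] [CompleteSpace 𝔸] [Fintype ι] [Fintype (geo9K i).Site] in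
/-- the volume factor of an index bond averaging the fine bond `f` is at most `(L^{d+1})^{J₀(f)+1}`, `J₀(f)` the level of `f`'s initial point (level window).
[cite: Balaban1984PropagatorsII, (2.2)–(2.4) p.224; Balaban1985BackgroundPropagators, (3.13) p.393] -/
theorem volY_le_of_qK_ne_zero {κ : IBondY i} {f : FBondY i} (h : qK i κ f ≠ 0) :
    volY i κ ≤ ((((ℓ + 1 : ℕ) : ℝ)) ^ (d + 1)) ^ (levY i (chartY i f.src) + 1) := by
  have hw := (levY_src_bounds_of_qwt_ne_zero i (y := κ) (f := f) (by rw [← qK_apply]; exact h)).1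
  have hL1 : (1 : ℝ) ≤ (((ℓ + 1 : ℕ) : ℝ)) ^ (d + 1) := one_le_pow₀ (by exact_mod_cast Nat.succ_le_succ (Nat.zero_le ℓ))
  unfold volY
  exact pow_le_pow_right₀ hL1 (by unfold lvl at hw; omega)

/-- ★★ **THE (3.15) BLOCK MAJORANT OF `Qsb = Q*(U)`** (print's weighted adjoint, `QsbVY = QsY∘diag(vol)∘res`) at a configuration with contractive averaging
transporters: for every `δ ≥ 0`, `QsbC parB b (base U) ≺ (M₂Σ_j‖b_j‖)·2L^{d+1}·e^{δ(ℓ+3)}·e^{−δ·d}`.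
[cite: Balaban1985BackgroundPropagators, (3.13)–(3.15) p.393; Balaban1984PropagatorsII, (2.51) p.232] -/
theorem hasMajorant_QsbC (hι : ∀ s : BlkY i, β i.hN i.D i.hk (ιB s) = s) {M₂ : ℝ} (hM₂ : 0 ≤ M₂)
    (hrepr : ∀ (v : 𝔸) (j : ι), |b.repr v j| ≤ M₂ * ‖v‖) {U : CfgY 𝔸 i}
    (hparU : ∀ s s', ‖(parB U s s' : 𝔸)‖ ≤ 1 ∧ ‖(((parB U s s')⁻¹ : 𝔸ˣ) : 𝔸)‖ ≤ 1) {δ : ℝ} (hδ : 0 ≤ δ) :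
    HasMajorant (g := toB6 (geo9K i) Rr Hp) (fun q : (Fin (d + 1) × SiteY i) × ι => blkC i ιB q.1.2) (QsbC i parB b (.base U))
      (fun a a' => (M₂ * ∑ j, ‖b j‖) *
        (2 * (((ℓ + 1 : ℕ) : ℝ)) ^ (d + 1) * Real.exp (δ * ((ℓ : ℝ) + 3)) * Real.exp (-(δ * (geo9K i).dist a a')))) := by
  classical
  have hQ : QsbC i parB b (.base U) = conj b (bondOpCoordsRY i ((QsbVY i parB U).restrictScalars ℝ)) := by
    rw [QsbC, restrictScalars_bondOpCoordsY, decY_base]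
  refine hasMajorant_of_eq i hQ (hasMajorant_conj_of_liftY_bound b (g := toB6 (geo9K i) Rr Hp) (fun z : Fin (d + 1) × SiteY i => blkC i ιB z.2)
    _ _ M₂ hM₂ hrepr fun f E y' B hE hB hoff hbd z => ?_)
  rw [bondOpCoordsRY_apply, LinearMap.restrictScalars_apply, Node00.bondFunCoordsY_apply]
  set Λ : FBondY i → 𝔸 := (bondFunCoordsY i).symm (liftY f E) with hΛ
  set bd : FBondY i := (bondCoordsY i).symm z with hbd'
  have hz2 : z.2 = B6GlobalChartV1.boxEquiv i.hN bd.src := by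
    have : z = bondCoordsY i bd := by rw [hbd', Equiv.apply_symm_apply]
    rw [this, bondCoordsY_apply]
  set LL : ℝ := (((ℓ + 1 : ℕ) : ℝ)) ^ (d + 1) with hLL
  have hL1 : (1 : ℝ) ≤ LL := one_le_pow₀ (by exact_mod_cast Nat.succ_le_succ (Nat.zero_le ℓ))
  set J₀ : ℕ := levY i (chartY i bd.src) with hJ₀
  -- the value: `Σ_κ qsK(bd, κ) · R(qT κ bd)⁻¹ (vol κ • Λ(rep κ))`
  have hval : QsbVY i parB U Λ bd = ∑ κ, ((qsK i bd κ : ℝ) : ℂ) • R (qT i parB U κ bd)⁻¹ (((volY i κ : ℝ) : ℂ) • Λ (repBondY i κ)) := by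
    simp only [QsbVY, LinearMap.comp_apply, QsY, trLiftY_apply, liftMatY_diagonal_apply, resBondY_apply]
  have hΛrep : ∀ κ, ‖Λ (repBondY i κ)‖ ≤ |f (bondCoordsY i (repBondY i κ))| := fun κ => by
    rw [hΛ, bondFunCoordsY_symm_liftY]; exact norm_real_smul_le hE
  -- termwise: `‖term κ‖ ≤ |qsK(bd,κ)|·vol(κ)·|f(coords(rep κ))|`
  have hterm : ∀ κ, ‖((qsK i bd κ : ℝ) : ℂ) • R (qT i parB U κ bd)⁻¹ (((volY i κ : ℝ) : ℂ) • Λ (repBondY i κ))‖ ≤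
      |qsK i bd κ| * (volY i κ * |f (bondCoordsY i (repBondY i κ))|) := by
    intro κ
    rw [norm_smul, Complex.norm_real, Real.norm_eq_abs]
    refine mul_le_mul_of_nonneg_left ?_ (abs_nonneg _)
    have h12 : ‖(qT i parB U κ bd : 𝔸)‖ ≤ 1 ∧ ‖(((qT i parB U κ bd)⁻¹ : 𝔸ˣ) : 𝔸)‖ ≤ 1 := hparU _ _
    refine (norm_R_le_of_unit _ _ ⟨h12.2, by rw [inv_inv]; exact h12.1⟩).trans ?_
    rw [norm_smul, Complex.norm_real, Real.norm_eq_abs, abs_of_pos (volY_pos i κ)]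
    exact mul_le_mul_of_nonneg_left (hΛrep κ) (volY_pos i κ).le
  rw [hval]
  by_cases hex : ∃ κ, qsK i bd κ ≠ 0 ∧ blkC i ιB (B6GlobalChartV1.boxEquiv i.hN (repBondY i κ).src) = y'
  · -- some averaging index bond of `bd` is represented in the block `y′`: the block of `bd` is within `ℓ + 3`
    obtain ⟨κ₀, hκ₀, hy'⟩ := hex
    have hdist : (geo9K i).dist (blkC i ιB z.2) y' ≤ (ℓ : ℝ) + 3 := by
      rw [hz2, ← hy', geo9K_dist_comm]; exact geo9K_dist_lab_of_qsK_ne_zero i ιB hι hκ₀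
    have hsum : ‖∑ κ, ((qsK i bd κ : ℝ) : ℂ) • R (qT i parB U κ bd)⁻¹ (((volY i κ : ℝ) : ℂ) • Λ (repBondY i κ))‖ ≤
        ∑ κ, |qsK i bd κ| * (LL ^ (J₀ + 1) * B) := by
      refine (norm_sum_le _ _).trans (Finset.sum_le_sum fun κ _ => (hterm κ).trans ?_)
      by_cases hq : qsK i bd κ = 0
      · rw [hq, abs_zero, zero_mul, zero_mul]
      · refine mul_le_mul_of_nonneg_left (mul_le_mul ?_ (hbd _) (abs_nonneg _) (by positivity)) (abs_nonneg _)
        have hq' : qK i κ bd ≠ 0 := by rw [Node00.qsK_eq_transpose, Matrix.transpose_apply] at hq; exact hq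
        exact volY_le_of_qK_ne_zero i hq'
    have hcol : ∑ κ, |qsK i bd κ| ≤ 2 * (LL ^ J₀)⁻¹ := sum_abs_qsK_le i bd
    have hLJ : (0 : ℝ) < LL ^ J₀ := by positivity
    calc ‖∑ κ, ((qsK i bd κ : ℝ) : ℂ) • R (qT i parB U κ bd)⁻¹ (((volY i κ : ℝ) : ℂ) • Λ (repBondY i κ))‖
        ≤ (∑ κ, |qsK i bd κ|) * (LL ^ (J₀ + 1) * B) := by rw [← Finset.sum_mul] at hsum; exact hsum
      _ ≤ 2 * (LL ^ J₀)⁻¹ * (LL ^ (J₀ + 1) * B) := mul_le_mul_of_nonneg_right hcol (by positivity)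
      _ = 2 * LL * 1 * B := by rw [pow_succ]; field_simp
      _ ≤ 2 * LL * (Real.exp (δ * ((ℓ : ℝ) + 3)) * Real.exp (-(δ * (geo9K i).dist (blkC i ιB z.2) y'))) * B := by
          gcongr; exact one_le_exp_mul_exp_neg hδ hdist
      _ = _ := by ring
  · -- no averaging index bond of `bd` is represented in `y′`: every term vanishes
    have hsum : ‖∑ κ, ((qsK i bd κ : ℝ) : ℂ) • R (qT i parB U κ bd)⁻¹ (((volY i κ : ℝ) : ℂ) • Λ (repBondY i κ))‖ ≤ ∑ κ : IBondY i, (0 : ℝ) := by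
      refine (norm_sum_le _ _).trans (Finset.sum_le_sum fun κ _ => (hterm κ).trans ?_)
      by_cases hq : qsK i bd κ = 0
      · rw [hq, abs_zero, zero_mul]
      · have hoff' : f (bondCoordsY i (repBondY i κ)) = 0 := by
          refine hoff _ fun h => hex ⟨κ, hq, ?_⟩
          rw [← h, bondCoordsY_apply]
        rw [hoff', abs_zero, mul_zero, mul_zero]
    rw [Finset.sum_const_zero] at hsum
    exact hsum.trans (by positivity)

/-! ## §4 ★★ the weight `a∕vol` read on fine bonds: FIELD `ha324` -/

omit [NormedRing 𝔸] [NormedAlgebra ℂ 𝔸] [CompleteSpace 𝔸] [Fintype ι] [Fintype (geo9K i).Site] in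
/-- ★ the index band IS `w_ι ∕ vol(ι) ≦ b₁·ℓ(ι)^{−2}` (`ℓ(ι) = L^{j(ι)}∕|c_f|`). [cite: Balaban1985BackgroundPropagators, (3.24) p.394, (3.26) p.395; Balaban1984PropagatorsII, (2.20) p.226] -/
theorem w_div_volY_le (κ : IBondY i) : i.w κ / volY i κ ≤ b₁ * ((geo9K i).len κ ^ 2)⁻¹ := by
  have hb := (i.hwb κ).2
  have hvol := volY_pos i κ
  have hcf : i.cf ≠ 0 := i.hcf
  have hLj : (0 : ℝ) < (((ℓ + 1 : ℕ) : ℝ)) ^ (κ.1.1 : ℕ) := by positivity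
  rw [geo9K_len_eq]
  unfold lvl
  have hden : (0 : ℝ) < (i.cf / (((ℓ + 1 : ℕ) : ℝ)) ^ (κ.1.1 : ℕ)) ^ 2 := by positivity
  rw [div_le_iff₀ hden] at hb
  rw [div_le_iff₀ hvol]
  have hlen : (((((ℓ + 1 : ℕ) : ℝ)) ^ (κ.1.1 : ℕ) / |i.cf|) ^ 2)⁻¹ = (i.cf / (((ℓ + 1 : ℕ) : ℝ)) ^ (κ.1.1 : ℕ)) ^ 2 := by
    rw [div_pow, div_pow, inv_div, sq_abs]
  rw [hlen]
  calc i.w κ ≤ b₁ * ((((ℓ + 1 : ℕ) : ℝ)) ^ (κ.1.1 : ℕ)) ^ (d + 1) * (i.cf / (((ℓ + 1 : ℕ) : ℝ)) ^ (κ.1.1 : ℕ)) ^ 2 := hb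
    _ = b₁ * (i.cf / (((ℓ + 1 : ℕ) : ℝ)) ^ (κ.1.1 : ℕ)) ^ 2 * volY i κ := by unfold volY; rw [← pow_mul, ← pow_mul, mul_comm (κ.1.1 : ℕ)]; ring

omit [CompleteSpace 𝔸] in
open Classical in
/-- ★★ **THE BLOCK-DIAGONAL MAJORANT OF THE WEIGHT LETTER `ab`** (`abVY = ext∘diag(w∕vol)∘res`): `abC b ≺ 𝟙[a = a′]·(M₂Σ_j‖b_j‖)·b₁·ℓ(a)^{−2}`.
[cite: Balaban1985BackgroundPropagators, (3.24) p.394, (3.26) p.395; Balaban1984PropagatorsII, (2.51) p.232] -/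
theorem hasMajorant_abC (hι : ∀ s : BlkY i, β i.hN i.D i.hk (ιB s) = s) {M₂ : ℝ} (hM₂ : 0 ≤ M₂)
    (hrepr : ∀ (v : 𝔸) (j : ι), |b.repr v j| ≤ M₂ * ‖v‖) (hb₁ : 0 ≤ b₁) :
    HasMajorant (g := toB6 (geo9K i) Rr Hp) (fun q : (Fin (d + 1) × SiteY i) × ι => blkC i ιB q.1.2) (abC (𝔸 := 𝔸) i b)
      (fun a a' => (M₂ * ∑ j, ‖b j‖) * (if a = a' then b₁ * ((geo9K i).len a ^ 2)⁻¹ else 0)) := by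
  classical
  have hQ : abC (𝔸 := 𝔸) i b = conj b (bondOpCoordsRY i ((abVY (𝔸 := 𝔸) i).restrictScalars ℝ)) := by
    rw [abC, restrictScalars_bondOpCoordsY]
  refine hasMajorant_of_eq i hQ (hasMajorant_conj_of_liftY_bound b (g := toB6 (geo9K i) Rr Hp) (fun z : Fin (d + 1) × SiteY i => blkC i ιB z.2)
    _ _ M₂ hM₂ hrepr fun f E y' B hE hB hoff hbd z => ?_)
  rw [bondOpCoordsRY_apply, LinearMap.restrictScalars_apply, Node00.bondFunCoordsY_apply]
  set Λ : FBondY i → 𝔸 := (bondFunCoordsY i).symm (liftY f E) with hΛ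
  by_cases hz : (bondCoordsY i).symm z ∈ Set.range (repBondY i)
  · obtain ⟨κ, hκ⟩ := hz
    have hzeq : z = bondCoordsY i (repBondY i κ) := by rw [hκ, Equiv.apply_symm_apply]
    have hz2 : blkC i ιB z.2 = ιB (β i.hN i.D i.hk κ) := by
      rw [hzeq, bondCoordsY_apply]
      show ιB (blkY i (B6GlobalChartV1.boxEquiv i.hN (repBondY i κ).src)) = _
      rw [blkY_repBondY_src]
    have hlen : (geo9K i).len (blkC i ιB z.2) = (geo9K i).len κ := by
      rw [hz2]; exact Node00.OpsYRead342.geo9K_len_congr i (hι _)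
    rw [← hκ]
    simp only [abVY, LinearMap.comp_apply, extBondY_apply_repBondY, liftMatY_diagonal_apply, resBondY_apply]
    rw [hκ, hΛ, bondFunCoordsY_symm_liftY, Equiv.apply_symm_apply, smul_smul, ← Complex.ofReal_mul]
    refine (norm_real_smul_le hE).trans ?_
    rw [abs_mul, abs_of_nonneg (div_nonneg (i.hw κ).le (volY_pos i κ).le)]
    split_ifs with hy
    · calc i.w κ / volY i κ * |f z| ≤ b₁ * ((geo9K i).len (blkC i ιB z.2) ^ 2)⁻¹ * B :=
            mul_le_mul (by rw [hlen]; exact w_div_volY_le i κ) (hbd z) (abs_nonneg _) (by positivity)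
        _ = _ := rfl
    · rw [hoff z hy, abs_zero, mul_zero, zero_mul]
  · simp only [abVY, LinearMap.comp_apply]
    rw [extBondY_apply_of_not_mem_range i _ hz, norm_zero]
    refine mul_nonneg ?_ hB
    split_ifs <;> positivity


end Literature.MathematicalPhysics.QuantumFieldTheory.Balaban1983to89.B9SectBQSizesY

end
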